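import Mathlib

/-!
# SEIL-F outer end: the read-out-mass bootstrap (solo-blind s87, kernel #197)

Architecture A‴ of LEMMA R (PLAN §109 (g)).  Let `U(t, τ)` be the propagator of the deleted
chain, `g(t)` the loop read-out covector, and for data `x` inserted at time `τ` let
`κ[x; τ] = ∫₀^∞ |g(τ+ℓ) · U(τ+ℓ, τ) x| e^{γℓ} dℓ` (the read-out MASS; sublinear in `x`).  On the
weighted mode space `ℓ¹_w` put `𝒦 = sup_{m, τ} κ[e_m; τ] / w_m`.  For any approximate trajectory
`z` with `z(0) = e_m`, residual `ρ = (∂_ℓ - A) z`, explicit mass `E_m = ∫ |g·z| e^{γℓ}` and residual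
mass `ε_m = ∫ ‖ρ(ℓ)‖_w e^{γℓ} dℓ`, Duhamel's formula gives `κ[e_m; τ] ≤ E_m + 𝒦 ε_m`.  The purely
order-theoretic consequence certified here is the BOOTSTRAP

  `E_m ≤ 𝓔 w_m`, `ε_m ≤ ε̄ w_m`, `ε̄ < 1`  ⟹  `𝒦 ≤ 𝓔 / (1 - ε̄)`,

and the resulting column-Schur assembly `Schur_col ≤ E_V + 𝒦 (‖V - V_app‖_w + ε_ρ)
≤ E_V + 𝓔 (‖V - V_app‖_w + ε_ρ) / (1 - ε̄)`.  The point for LEMMA R: every parametrix error is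
multiplied by `𝒦 = O(1/P)` (the true chain's read-out masses carry all the dephasing), so the
parametrix needs only relative accuracy `ε̄ < 1`, not `O(1/P)`.

Only real-number order reasoning is done here; the Duhamel inequality is the hypothesis `hduh`.
-/

namespace Summit.AnomalousDissipation.AnomalousDissipation.Theorems

/-- Scalar bootstrap: `0 ≤ K`, `K ≤ E + K ε`, `ε < 1` imply `K ≤ E / (1 - ε)`. -/
theorem bootstrap_scalar {K E ε : ℝ} (hε : ε < 1) (h : K ≤ E + K * ε) :
    K ≤ E / (1 - ε) := by
  have h1 : 0 < 1 - ε := sub_pos.mpr hε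
  rw [le_div_iff₀ h1]
  nlinarith

/-- The read-out-mass bootstrap over a family of modes `m : ι` with weights `w_m > 0`.
`κ m` = true read-out mass of unit mode data, `E m` = explicit (parametrix) mass, `ε m` = residual
mass; `𝒦 = ⨆ m, κ m / w m`.  Hypotheses: the Duhamel inequality `κ m ≤ E m + 𝒦 · ε m`, the
uniform relative bounds `E m ≤ 𝓔 w m`, `ε m ≤ ε̄ w m` with `ε̄ < 1`, nonnegativity of `κ`, and
finiteness of `𝒦` (`BddAbove`, automatic for each fixed `P` by damping). Conclusion:
`𝒦 ≤ 𝓔 / (1 - ε̄)`. -/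
theorem readoutMass_bootstrap {ι : Type*} [Nonempty ι] (κ E ε w : ι → ℝ) (𝓔 εbar : ℝ)
    (hw : ∀ m, 0 < w m) (hκ : ∀ m, 0 ≤ κ m)
    (hbdd : BddAbove (Set.range fun m => κ m / w m))
    (hE : ∀ m, E m ≤ 𝓔 * w m) (hε : ∀ m, ε m ≤ εbar * w m)
    (hεbar : εbar < 1)
    (hduh : ∀ m, κ m ≤ E m + (⨆ n, κ n / w n) * ε m) :
    (⨆ n, κ n / w n) ≤ 𝓔 / (1 - εbar) := by
  set K := ⨆ n, κ n / w n with hKdef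
  have hK0 : 0 ≤ K := by
    obtain ⟨m⟩ := ‹Nonempty ι›
    exact le_trans (div_nonneg (hκ m) (le_of_lt (hw m))) (le_ciSup hbdd m)
  have hbound : ∀ m, κ m / w m ≤ 𝓔 + K * εbar := by
    intro m
    have hwm := hw m
    rw [div_le_iff₀ hwm]
    have h1 : K * ε m ≤ K * (εbar * w m) := mul_le_mul_of_nonneg_left (hε m) hK0
    have h2 := hduh m
    have h3 := hE m
    nlinarith
  have hK : K ≤ 𝓔 + K * εbar := ciSup_le hbound
  exact bootstrap_scalar hεbar hK

/-- Pointwise consequence: every mode's true read-out mass is at most `𝓔 w_m / (1 - ε̄)`. -/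
theorem readoutMass_mode_bound {ι : Type*} [Nonempty ι] (κ E ε w : ι → ℝ) (𝓔 εbar : ℝ)
    (hw : ∀ m, 0 < w m) (hκ : ∀ m, 0 ≤ κ m)
    (hbdd : BddAbove (Set.range fun m => κ m / w m))
    (hE : ∀ m, E m ≤ 𝓔 * w m) (hε : ∀ m, ε m ≤ εbar * w m)
    (hεbar : εbar < 1)
    (hduh : ∀ m, κ m ≤ E m + (⨆ n, κ n / w n) * ε m) (m : ι) :
    κ m ≤ 𝓔 / (1 - εbar) * w m := by
  have hK := readoutMass_bootstrap κ E ε w 𝓔 εbar hw hκ hbdd hE hε hεbar hduh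
  have h1 : κ m / w m ≤ ⨆ n, κ n / w n := le_ciSup hbdd m
  have h2 : κ m / w m ≤ 𝓔 / (1 - εbar) := le_trans h1 hK
  rwa [div_le_iff₀ (hw m)] at h2

/-- Column-Schur assembly of LEMMA R (A‴): if the column mass satisfies the Duhamel split
`S ≤ E_V + 𝒦 (e_V + ε_ρ)` (explicit frame-parametrix mass plus 𝒦 times frame error and residual
mass, both `≥ 0`) and `𝒦 ≤ 𝓔/(1-ε̄)`, then `S ≤ E_V + 𝓔 (e_V + ε_ρ) / (1 - ε̄)`. -/
theorem schurColumn_assembly {S E_V 𝒦 e_V ε_ρ 𝓔 εbar : ℝ}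
    (hS : S ≤ E_V + 𝒦 * (e_V + ε_ρ)) (hK : 𝒦 ≤ 𝓔 / (1 - εbar))
    (he : 0 ≤ e_V) (hρ : 0 ≤ ε_ρ) :
    S ≤ E_V + 𝓔 * (e_V + ε_ρ) / (1 - εbar) := by
  have h1 : 𝒦 * (e_V + ε_ρ) ≤ 𝓔 / (1 - εbar) * (e_V + ε_ρ) :=
    mul_le_mul_of_nonneg_right hK (add_nonneg he hρ)
  have h2 : 𝓔 / (1 - εbar) * (e_V + ε_ρ) = 𝓔 * (e_V + ε_ρ) / (1 - εbar) := by ring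
  linarith [h2 ▸ h1]

/-- The LEMMA R threshold in this architecture: if all constants scale as stated —
`E_V ≤ C₀ / P`, `𝓔 ≤ C₁ / P`, `e_V + ε_ρ ≤ D` — then `S ≤ (C₀ + C₁ D / (1 - ε̄)) / P`, so the
column Schur norm is `< 1` as soon as `P > C₀ + C₁ D / (1 - ε̄)`. -/
theorem schurColumn_threshold {S E_V 𝒦 e_V ε_ρ 𝓔 εbar C₀ C₁ D P : ℝ} (hP : 0 < P)
    (hS : S ≤ E_V + 𝒦 * (e_V + ε_ρ)) (hK : 𝒦 ≤ 𝓔 / (1 - εbar)) (hεbar : εbar < 1)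
    (he : 0 ≤ e_V) (hρ : 0 ≤ ε_ρ) (hEV : E_V ≤ C₀ / P) (h𝓔 : 𝓔 ≤ C₁ / P) (hC₁ : 0 ≤ C₁)
    (hD : e_V + ε_ρ ≤ D) (hPR : C₀ + C₁ * D / (1 - εbar) < P) :
    S < 1 := by
  have h1 := schurColumn_assembly hS hK he hρ
  have hε1 : 0 < 1 - εbar := sub_pos.mpr hεbar
  have hsum : 0 ≤ e_V + ε_ρ := add_nonneg he hρ
  -- 𝓔 (e_V + ε_ρ) ≤ (C₁/P) D
  have h2 : 𝓔 * (e_V + ε_ρ) ≤ C₁ / P * D := by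
    have h21 : 𝓔 * (e_V + ε_ρ) ≤ C₁ / P * (e_V + ε_ρ) := mul_le_mul_of_nonneg_right h𝓔 hsum
    have h22 : C₁ / P * (e_V + ε_ρ) ≤ C₁ / P * D :=
      mul_le_mul_of_nonneg_left hD (div_nonneg hC₁ (le_of_lt hP))
    linarith
  have h3 : 𝓔 * (e_V + ε_ρ) / (1 - εbar) ≤ C₁ / P * D / (1 - εbar) :=
    div_le_div_of_nonneg_right h2 (le_of_lt hε1)
  have h4 : S ≤ C₀ / P + C₁ / P * D / (1 - εbar) := by linarith
  have h5 : C₀ / P + C₁ / P * D / (1 - εbar) = (C₀ + C₁ * D / (1 - εbar)) / P := by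
    field_simp
  rw [h5] at h4
  have h6 : (C₀ + C₁ * D / (1 - εbar)) / P < 1 := by
    rw [div_lt_one hP]; exact hPR
  linarith

end Summit.AnomalousDissipation.AnomalousDissipation.Theorems
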